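import Literature.NumberTheory.GaloisRepresentations.GalLayerSystemSubgroupLayers
import Literature.NumberTheory.GaloisRepresentations.GalLayerSystemIdele
import Literature.NumberTheory.GaloisRepresentations.IdeleClassFundamentalClassTower
import Literature.Algebra.Homology.ClassModuleInvariant
import Literature.Algebra.Homology.DiscreteRepLayerColimitDesc
import HarnessLib

/-!
# The invariant maps of the RELATIVE layers of `C̄`: `inv : H²(H_E, C_E) ⥲ (1/|H_E|)ℤ/ℤ` at the subgroups
# `H_E = Gal(E/L) ≤ Gal(E/F)`, compatible with the relative inflations (Serre, *Local Fields* XI §2–§3;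
# Tate, C–F VII §11.2 (bis))

Topic `NumberTheory/GaloisRepresentations`; namespace `Literature.NumberTheory.GaloisRepresentations.IdeleClassBar`.
Sequel to door-c6 g15's `GalLayerSystemSubgroupLayers.lean` (the relative layers of `C̄ = lim→ C_E` at a subgroup
`U ≤ Γ_F`: `GalLayer.subgroupImage U E = H_E`, `D.relLayerCohomologyIso : Hⁿ(U ⧸ (U_E ∩ U), (Res_U C̄)^{U_E ∩ U}) ≅
Hⁿ(H_E, Res_{H_E} C_E)`, `relLayerCohomologyIso_stepG`, `res_comp_relInf`), door-c5's `GalLayerSystemIdele.lean`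
(`classData F`, `classData_inf = classInf`), door-c5/door-c4's `IdeleClassFundamentalClassTower.lean` (THE canonical
class-module structure of a layer `(Gal(E/F), C_E)` with fundamental class `u_{E/F}`; `Inf u_E = [M:E] · u_M`) and
door-c4 g16's `ClassModuleInvariant.lean` (`IsClassModule.inv/invSub`, `inv_U ∘ res = [G:U] · inv_G`).  Definitions
with bodies (`layerCocycle`, `relLayerInv`, `subLayerTrace`) and theorems; NO named fact, no `sorry`, no instance, no
notation; number fields in `Type`, `Γ_F = Field.absoluteGaloisGroup F`.

THE POINT.  Door-c4's Tate duality theorem (`DiscreteRepTateDuality`) for `(Γ_F, C̄)` needs the invariant maps AT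
EVERY OPEN (NORMAL) SUBGROUP `U = Gal(F̄/L)`: `inv_U : H²(U, C̄) ⥲ ℚ/ℤ` with `inv_U ∘ res = [Γ_F : U] · inv_F`.  By
door-c4's colimit theorem (d) at `U` (door-c6: trace layers) `H²(U, C̄) = lim→_{E ⊇ L} H²(H_E, C_E)` over the relative
layers, `H_E = Gal(E/L) ≤ Gal(E/F)`.  Each `(Gal(E/F), C_E)` is a class module with fundamental class `u_E`
(door-c4 g11 / door-c5), so `H²(H_E, C_E) = ℤ · res u_E` is cyclic of order `|H_E| = [E:L]` and carries the
invariant map `inv_{H_E} : res u_E ↦ 1/|H_E|` (`ClassModuleInvariant`).  This file packages these as a COMPATIBLE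
FAMILY over the cofinal family of trace layers (`isCompatibleFamily_relLayerInv`): compatibility with the relative
inflations `H²(H_E, C_E) → H²(H_{E'}, C_{E'})` is `Inf u_E = [E':E] · u_{E'}` restricted to the subgroups together
with `|H_{E'}| = [E':E] · |H_E|`.  Index bookkeeping: `[Gal(E/F) : H_E] = [Γ_F : U]`, `|H_E| · [Γ_F : U] = [E:F]`.
The descended map `inv_U` on `Ext²_{C_U}(ℤ, Res_U C̄)`, its bijectivity and the `Res`-axiom are the sequel
`IdeleClassBarInvariantSubgroup.lean`.

## What is formalised (`F : Type` a number field, `Γ = absoluteGaloisGroup F`, `U : Subgroup Γ`, `E : GalLayer F`)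

* §14 `layerCocycle F E`, `isClassModule_layerCocycle`, `H2π_layerCocycle` (THE class-module structure of
  `(Gal(E/F), C_E)` with class `u_E`), **`inv_layerCocycle_apply : inv (x) = classInvAll F E x`** (the class-module
  invariant IS the cell's `inv_{E/F}`).
* §15 `GalLayer.restrictHom_ker`, **`index_subgroupImage : [Gal(E/F) : H_E] = [Γ : U]`** (`U_E ≤ U`),
  `card_subgroupImage_mul_index : |H_E| · [Γ : U] = [E:F]`, `index_ne_zero_of_le`, `finrank_dvd_of_le`,
  **`card_subgroupImage_eq_mul : |H_{E'}| = [E':E] · |H_E|`**.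
* §16 **`relLayerInv U hE : H²(U ⧸ (U_E ∩ U), (Res_U C̄)^{U_E ∩ U}) →+ ℚ/ℤ`** (`= inv_{H_E} ∘ relLayerCohomologyIso`),
  `relLayerInv_injective`, `exists_relLayerInv_eq` (every `r/|H_E|` is a value), **`relLayerInv_stepG`**
  (compatibility with door-c4's transitions for the group `U`), `subLayerTrace`, **`isCompatibleFamily_relLayerInv`**.

HONEST FRAMING: classical class field theory bookkeeping in the tree's normalisation; no case of BSD or of Poitou–Tate
is proved.  Route A (A5)-ARITH of crux `AnticycControlAdditiveK` (item 19295, cell bsd-schneider), seat door-c4 gen 16.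

## References
* J.-P. Serre, *Local Fields*, GTM 67 (1979), XI §2 Prop. 1, §3 (`inv_{E′} ∘ Res = [E′:E] · inv_E`, fundamental classes). [Serre1979]
* J. W. S. Cassels, A. Fröhlich (eds.), *Algebraic Number Theory* (1967), Ch. VII (J. Tate) §11.2 (bis), §11.3. [CasselsFrohlichANT1967]
* J.-P. Serre, *Galois Cohomology* (1997), I §2.2 Proposition 8. [SerreGaloisCohomology1997]
-/

noncomputable section

open NumberField CategoryTheory groupCohomology
open Field (absoluteGaloisGroup)
open Literature.NumberTheory.Automorphic Literature.NumberTheory.Automorphic.IdeleClassGroup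
open Literature.NumberTheory.NumberFields
open Literature.Algebra.Homology Literature.Algebra.Homology.DiscreteRep
open Literature.AnabelianGeometry.AbsoluteAnabelian.Prop121vii (zmodToQmodZ)
open scoped Classical

namespace Literature.NumberTheory.GaloisRepresentations

namespace IdeleClassBar

variable (F : Type) [Field F] [NumberField F]

/-! ## §14. THE class-module structure of a layer `(Gal(E/F), C_E)` and its invariant map -/

/-- **A 2-cocycle representing the fundamental class `u_{E/F}`, for which `(Gal(E/F), C_E)` is a class module**
(door-c5/door-c4 `exists_isClassModule_H2π_eq_fundamentalClassAll`, chosen once and for all).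
[cite: CasselsFrohlichANT1967, Ch. VII §11.3] -/
def layerCocycle (E : GalLayer F) : cocycles₂ ((classData F).obj E) :=
  haveI := E.numberField
  haveI := E.isGalois
  (IdeleCohomology.exists_isClassModule_H2π_eq_fundamentalClassAll F E.1).choose

/-- `(Gal(E/F), C_E)` is a class module with the cocycle `layerCocycle F E`. [cite: CasselsFrohlichANT1967, Ch. VII §11.3] -/
theorem isClassModule_layerCocycle (E : GalLayer F) : IsClassModule ((classData F).obj E) (layerCocycle F E) :=
  haveI := E.numberField
  haveI := E.isGalois
  (IdeleCohomology.exists_isClassModule_H2π_eq_fundamentalClassAll F E.1).choose_spec.1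

/-- `[layerCocycle F E] = u_{E/F}`. [cite: CasselsFrohlichANT1967, Ch. VII §11.3] -/
theorem H2π_layerCocycle (E : GalLayer F) :
    H2π ((classData F).obj E) (layerCocycle F E) =
      (haveI := E.numberField; haveI := E.isGalois; IdeleCohomology.fundamentalClassAll F E.1) :=
  haveI := E.numberField
  haveI := E.isGalois
  (IdeleCohomology.exists_isClassModule_H2π_eq_fundamentalClassAll F E.1).choose_spec.2

omit [NumberField F] in
/-- `Gal(E/F)` is finite. [cite: SerreGaloisCohomology1997, I §2.2] -/
theorem finite_gal (E : GalLayer F) : Finite (E.1 ≃ₐ[F] E.1) :=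
  haveI := E.finiteDimensional
  inferInstance

omit [NumberField F] in
/-- `|Gal(E/F)| = [E:F]`. [cite: SerreGaloisCohomology1997, I §2.2] -/
theorem natCard_gal (E : GalLayer F) : Nat.card (E.1 ≃ₐ[F] E.1) = Module.finrank F E.1 :=
  haveI := E.finiteDimensional
  haveI := E.isGalois
  IsGalois.card_aut_eq_finrank F E.1

/-- `1/n ∈ ℚ/ℤ`: the generic `oneDiv n` is the cell's `zmodToQmodZ n 1`. [cite: Serre1979, XI §3] -/
theorem oneDiv_eq_zmodToQmodZ (n : ℕ) [NeZero n] : oneDiv n = zmodToQmodZ n 1 := by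
  rw [oneDiv, UnitsLayer.zmodToQmodZ_one_eq]

/-- **The class-module invariant of the layer `(Gal(E/F), C_E)` IS the cell's `inv_{E/F}`** (`classInvAll F E`):
both are additive on `H²(Gal(E/F), C_E) = ℤ · u_E` with value `1/[E:F] = 1/|Gal(E/F)|` on `u_E`.
[cite: CasselsFrohlichANT1967, Ch. VII §11.2 (bis)][cite: Serre1979, XI §3] -/
theorem inv_layerCocycle_apply (E : GalLayer F) (x : groupCohomology ((classData F).obj E) 2) :
    (haveI := finite_gal F E; (isClassModule_layerCocycle F E).inv x) =
      (haveI := E.numberField; haveI := E.isGalois; IdeleCohomology.classInvAll F E.1 x) := by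
  haveI := E.numberField
  haveI := E.isGalois
  haveI := finite_gal F E
  haveI := IdeleCohomology.neZero_finrank F E.1
  have h := (isClassModule_layerCocycle F E).eq_inv_of_apply_H2π (IdeleCohomology.classInvAll F E.1) (by
    rw [H2π_layerCocycle, natCard_gal, oneDiv_eq_zmodToQmodZ]
    exact IdeleCohomology.classInvAll_fundamentalClassAll F E.1)
  exact (DFunLike.congr_fun h x).symm

/-! ## §15. Index bookkeeping: `[Gal(E/F) : H_E] = [Γ : U]`, `|H_E| · [Γ : U] = [E:F]` -/

omit [NumberField F] in
/-- The kernel of `σ ↦ σ|_E` is `U_E = Gal(F̄/E)`. [cite: SerreGaloisCohomology1997, I §2.2] -/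
theorem GalLayer.restrictHom_ker (E : GalLayer F) :
    E.restrictHom.ker = (E.openNormalSubgroup : Subgroup (absoluteGaloisGroup F)) :=
  Subgroup.ext fun σ => by rw [MonoidHom.mem_ker]; exact GalLayer.restrictHom_eq_one_iff E σ

variable {F}

omit [NumberField F] in
/-- **`[Gal(E/F) : H_E] = [Γ_F : U]`** for `U_E ≤ U` (`H_E` is the image of `U` under the surjection `σ ↦ σ|_E` whose
kernel `U_E` lies in `U`). [cite: SerreGaloisCohomology1997, I §2.2] -/
theorem index_subgroupImage (U : Subgroup (absoluteGaloisGroup F)) (E : GalLayer F)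
    (hE : (E.openNormalSubgroup : Subgroup (absoluteGaloisGroup F)) ≤ U) :
    (GalLayer.subgroupImage U E).index = U.index := by
  rw [GalLayer.subgroupImage, Subgroup.index_map, MonoidHom.range_eq_top_of_surjective _ E.restrictHom_surjective,
    Subgroup.index_top, mul_one, GalLayer.restrictHom_ker, sup_eq_left.2 hE]

omit [NumberField F] in
/-- **`|H_E| · [Γ_F : U] = [E:F]`** for `U_E ≤ U`. [cite: SerreGaloisCohomology1997, I §2.2] -/
theorem card_subgroupImage_mul_index (U : Subgroup (absoluteGaloisGroup F)) (E : GalLayer F)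
    (hE : (E.openNormalSubgroup : Subgroup (absoluteGaloisGroup F)) ≤ U) :
    Nat.card (GalLayer.subgroupImage U E) * U.index = Module.finrank F E.1 := by
  rw [← index_subgroupImage U E hE, Subgroup.card_mul_index, natCard_gal]

omit [NumberField F] in
/-- `[Γ_F : U] ≠ 0` as soon as `U` contains some `U_E`. [cite: SerreGaloisCohomology1997, I §2.2] -/
theorem index_ne_zero_of_le (U : Subgroup (absoluteGaloisGroup F)) (E : GalLayer F)
    (hE : (E.openNormalSubgroup : Subgroup (absoluteGaloisGroup F)) ≤ U) : U.index ≠ 0 := by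
  haveI := E.finiteDimensional
  intro h
  have h' := card_subgroupImage_mul_index U E hE
  rw [h, mul_zero] at h'
  exact Module.finrank_pos.ne' h'.symm

omit [NumberField F] in
/-- `|H_E| ≠ 0`. [cite: SerreGaloisCohomology1997, I §2.2] -/
theorem card_subgroupImage_ne_zero (U : Subgroup (absoluteGaloisGroup F)) (E : GalLayer F) :
    Nat.card (GalLayer.subgroupImage U E) ≠ 0 := by
  haveI := finite_gal F E
  exact Nat.card_pos.ne'

omit [NumberField F] in
/-- `[E':F] = [E:F] · [E':E]` for layers `E ≤ E'` (tower law). [cite: SerreGaloisCohomology1997, I §2.2] -/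
theorem finrank_eq_mul_of_le {E E' : GalLayer F} (h : E ≤ E') :
    Module.finrank F E'.1 = Module.finrank F E.1 * (letI := GalLayer.algebraOfLE h; Module.finrank E.1 E'.1) := by
  letI := GalLayer.algebraOfLE h
  haveI := GalLayer.isScalarTower_of_le h
  exact (Module.finrank_mul_finrank F E.1 E'.1).symm

omit [NumberField F] in
/-- `[E:F] ∣ [E':F]` for `E ≤ E'`. [cite: SerreGaloisCohomology1997, I §2.2] -/
theorem finrank_dvd_of_le {E E' : GalLayer F} (h : E ≤ E') : Module.finrank F E.1 ∣ Module.finrank F E'.1 :=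
  Dvd.intro _ (finrank_eq_mul_of_le h).symm

omit [NumberField F] in
/-- **`|H_{E'}| = [E':E] · |H_E|`** for `E ≤ E'` with `U_E ≤ U` (both sides times `[Γ_F : U]` equal `[E':F]`).
[cite: Serre1979, XI §2 Proposition 1][cite: SerreGaloisCohomology1997, I §2.2] -/
theorem card_subgroupImage_eq_mul (U : Subgroup (absoluteGaloisGroup F)) {E E' : GalLayer F}
    (hE : (E.openNormalSubgroup : Subgroup (absoluteGaloisGroup F)) ≤ U) (h : E ≤ E') :
    Nat.card (GalLayer.subgroupImage U E') =
      (letI := GalLayer.algebraOfLE h; Module.finrank E.1 E'.1) * Nat.card (GalLayer.subgroupImage U E) := by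
  letI := GalLayer.algebraOfLE h
  have hE' : (E'.openNormalSubgroup : Subgroup (absoluteGaloisGroup F)) ≤ U :=
    (GalLayer.coe_openNormalSubgroup_le h).trans hE
  have h1 : Nat.card (GalLayer.subgroupImage U E') * U.index = Module.finrank F E'.1 :=
    card_subgroupImage_mul_index U E' hE'
  have h2 : Nat.card (GalLayer.subgroupImage U E) * U.index = Module.finrank F E.1 :=
    card_subgroupImage_mul_index U E hE
  have h3 : Module.finrank F E'.1 = Module.finrank F E.1 * Module.finrank E.1 E'.1 := finrank_eq_mul_of_le h
  refine Nat.eq_of_mul_eq_mul_right (Nat.pos_of_ne_zero (index_ne_zero_of_le U E hE)) ?_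
  calc Nat.card (GalLayer.subgroupImage U E') * U.index
      = Module.finrank F E.1 * Module.finrank E.1 E'.1 := h1.trans h3
    _ = Module.finrank E.1 E'.1 * Nat.card (GalLayer.subgroupImage U E) * U.index := by rw [← h2]; ring

/-! ## §16. The invariant maps of the relative layers, as a compatible family over the trace layers -/

/-- A morphism of `ModuleCat ℤ` commutes with integer multiples (stated at this generality so that the instance
paths are those of the cohomology objects). [folklore] -/
private theorem moduleCat_hom_zsmul {X Y : ModuleCat.{0} ℤ} (f : X ⟶ Y) (r : ℤ) (x : X) : f (r • x) = r • f x :=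
  map_zsmul (ConcreteCategory.hom f) r x

/-- A morphism of `ModuleCat ℤ` commutes with natural multiples. [folklore] -/
private theorem moduleCat_hom_nsmul {X Y : ModuleCat.{0} ℤ} (f : X ⟶ Y) (m : ℕ) (x : X) : f (m • x) = m • f x :=
  map_nsmul (ConcreteCategory.hom f) m x

section Relative

variable (U : Subgroup (absoluteGaloisGroup F))

/-- **The invariant map of the relative layer at `E` (`U_E ≤ U`):
`H²(U ⧸ (U_E ∩ U), (Res_U C̄)^{U_E ∩ U}) →+ ℚ/ℤ`**, the class-module invariant `inv_{H_E}` (`res u_E ↦ 1/|H_E|`) of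
the subgroup `H_E ≤ Gal(E/F)` transported along door-c6's `relLayerCohomologyIso`.
[cite: Serre1979, XI §3][cite: CasselsFrohlichANT1967, Ch. VII §11.2 (bis)] -/
def relLayerInv {E : GalLayer F} (hE : (E.openNormalSubgroup : Subgroup (absoluteGaloisGroup F)) ≤ U) :
    groupCohomology ((classData F).relLayerRep U E) 2 →+ AddCircle (1 : ℚ) :=
  haveI := finite_gal F E
  ((isClassModule_layerCocycle F E).invSub (GalLayer.subgroupImage U E)).comp
    ((classData F).relLayerCohomologyIso (U := U) hE 2).hom.hom.toAddMonoidHom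

set_option maxHeartbeats 1000000 in
-- the `ℤ`-module instance paths of `H²(H_E, Res C_E)` (door-c6 g15's note) make the coercion bookkeeping slow
/-- Formula. [cite: Serre1979, XI §3] -/
theorem relLayerInv_apply {E : GalLayer F} (hE : (E.openNormalSubgroup : Subgroup (absoluteGaloisGroup F)) ≤ U)
    (c : groupCohomology ((classData F).relLayerRep U E) 2) :
    relLayerInv U hE c = (haveI := finite_gal F E;
      (isClassModule_layerCocycle F E).invSub (GalLayer.subgroupImage U E)
        (((classData F).relLayerCohomologyIso (U := U) hE 2).hom c)) := by
  rw [relLayerInv, AddMonoidHom.coe_comp, Function.comp_apply, LinearMap.toAddMonoidHom_coe]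

/-- **`relLayerInv` is injective** (`inv_{H_E}` is, `relLayerCohomologyIso` is an isomorphism).
[cite: Serre1979, XI §2 Proposition 1] -/
theorem relLayerInv_injective {E : GalLayer F} (hE : (E.openNormalSubgroup : Subgroup (absoluteGaloisGroup F)) ≤ U) :
    Function.Injective (relLayerInv U hE) := by
  haveI := finite_gal F E
  intro c c' h
  rw [relLayerInv_apply, relLayerInv_apply] at h
  have h' := (isClassModule_layerCocycle F E).invSub_injective (GalLayer.subgroupImage U E) h
  have := congrArg ((classData F).relLayerCohomologyIso (U := U) hE 2).inv h'
  rwa [← ModuleCat.comp_apply, ← ModuleCat.comp_apply, Iso.hom_inv_id, ModuleCat.id_apply,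
    ModuleCat.id_apply] at this

/-- The restricted fundamental class `res_{H_E} u_E ∈ H²(H_E, Res C_E)`. [cite: Serre1979, XI §3] -/
abbrev resFundamentalClass (E : GalLayer F) :
    groupCohomology (Rep.res (GalLayer.subgroupImage U E).subtype ((classData F).obj E)) 2 :=
  groupCohomology.map (GalLayer.subgroupImage U E).subtype
    (𝟙 (Rep.res (GalLayer.subgroupImage U E).subtype ((classData F).obj E))) 2
    (H2π ((classData F).obj E) (layerCocycle F E))

/-- `inv_{H_E} (r • res u_E) = r/|H_E|` (the generic `invSub_zsmul` on the restricted fundamental class).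
[cite: Serre1979, XI §3] -/
theorem invSub_zsmul_resFundamentalClass (E : GalLayer F) (r : ℤ) :
    (haveI := finite_gal F E;
      (isClassModule_layerCocycle F E).invSub (GalLayer.subgroupImage U E) (r • resFundamentalClass U E)) =
      r • oneDiv (Nat.card (GalLayer.subgroupImage U E)) :=
  haveI := finite_gal F E
  (isClassModule_layerCocycle F E).invSub_zsmul (GalLayer.subgroupImage U E) r

/-- `relLayerInv (iso⁻¹ (r • res u_E)) = r/|H_E|`. [cite: Serre1979, XI §3] -/
theorem relLayerInv_iso_inv_zsmul {E : GalLayer F}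
    (hE : (E.openNormalSubgroup : Subgroup (absoluteGaloisGroup F)) ≤ U) (r : ℤ) :
    relLayerInv U hE (((classData F).relLayerCohomologyIso (U := U) hE 2).inv (r • resFundamentalClass U E)) =
      r • oneDiv (Nat.card (GalLayer.subgroupImage U E)) := by
  haveI := finite_gal F E
  rw [relLayerInv_apply, ← ModuleCat.comp_apply, Iso.inv_hom_id, ModuleCat.id_apply]
  exact invSub_zsmul_resFundamentalClass U E r

/-- **Every `r/|H_E|` is a value of `relLayerInv`** (at the class `iso⁻¹ (r • res u_E)`).
[cite: Serre1979, XI §3] -/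
theorem exists_relLayerInv_eq {E : GalLayer F} (hE : (E.openNormalSubgroup : Subgroup (absoluteGaloisGroup F)) ≤ U)
    (r : ℤ) : ∃ c : groupCohomology ((classData F).relLayerRep U E) 2,
      relLayerInv U hE c = r • oneDiv (Nat.card (GalLayer.subgroupImage U E)) :=
  ⟨_, relLayerInv_iso_inv_zsmul U hE r⟩

/-- Every class of `H²(H_E, Res C_E)` is an integer multiple of `res u_E`. [cite: Serre1979, XI §3] -/
theorem exists_zsmul_resFundamentalClass_eq (E : GalLayer F)
    (x : groupCohomology (Rep.res (GalLayer.subgroupImage U E).subtype ((classData F).obj E)) 2) :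
    ∃ r : ℤ, r • resFundamentalClass U E = x :=
  (isClassModule_layerCocycle F E).exists_zsmul_map_subtype_H2π_eq _ x

set_option maxHeartbeats 1000000 in
-- as above: instance-path unification in `rw`
/-- **The relative inflation of the restricted fundamental class: `relInf (res_{H_E} u_E) = [E':E] · res_{H_{E'}} u_{E'}`**
(`res ≫ relInf = Inf ≫ res`, door-c6 `res_comp_relInf`; `Inf u_E = [E':E] · u_{E'}`, door-c5 `classInf_fundamentalClassAll`).
[cite: Serre1979, XI §3][cite: CasselsFrohlichANT1967, Ch. VII §11.2 (bis)] -/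
theorem relInf_resFundamentalClass {E E' : GalLayer F} (h : E ≤ E') :
    (classData F).relInf U h 2 (resFundamentalClass U E) =
      (letI := GalLayer.algebraOfLE h; Module.finrank E.1 E'.1) • resFundamentalClass U E' := by
  haveI := E.numberField
  haveI := E'.numberField
  haveI := E.isGalois
  haveI := E'.isGalois
  letI := GalLayer.algebraOfLE h
  haveI := GalLayer.isScalarTower_of_le h
  -- `Inf u_E = [E':E] • u_{E'}` for the inflation of the system
  have hinf : (classData F).inf h 2 (H2π ((classData F).obj E) (layerCocycle F E)) =
      Module.finrank E.1 E'.1 • H2π ((classData F).obj E') (layerCocycle F E') := by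
    rw [H2π_layerCocycle, H2π_layerCocycle, classData_inf h 2]
    exact IdeleCohomology.classInf_fundamentalClassAll F E.1 E'.1
  -- `res ≫ relInf = inf ≫ res`
  have hc := congrArg (fun φ => φ (H2π ((classData F).obj E) (layerCocycle F E)))
    ((classData F).res_comp_relInf (U := U) h 2)
  simp only [ModuleCat.comp_apply] at hc
  rw [hc, hinf, moduleCat_hom_nsmul]

set_option maxHeartbeats 1000000 in
-- as above: instance-path unification in `rw`
/-- **Compatibility of the relative invariants with door-c4's transitions for the group `U`**: for `E ≤ E'`
(`U_E ≤ U`), `relLayerInv_{E'} (stepG c) = relLayerInv_E (c)` — the transition is the relative inflation under the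
isomorphisms (door-c6), `relInf (r · res u_E) = r [E':E] · res u_{E'}`, and `[E':E] · (1/|H_{E'}|) = 1/|H_E|`.
[cite: Serre1979, XI §2 Proposition 1, §3][cite: SerreGaloisCohomology1997, I §2.2 Proposition 8] -/
theorem relLayerInv_stepG {E E' : GalLayer F}
    (hE : (E.openNormalSubgroup : Subgroup (absoluteGaloisGroup F)) ≤ U)
    (hE' : (E'.openNormalSubgroup : Subgroup (absoluteGaloisGroup F)) ≤ U) (h : E ≤ E')
    (c : groupCohomology ((classData F).relLayerRep U E) 2) :
    relLayerInv U hE' (LayerColimit.stepG (traceOpenNormalSubgroup U E.openNormalSubgroup)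
        (traceOpenNormalSubgroup U E'.openNormalSubgroup)
        (traceOpenNormalSubgroup_mono U (GalLayer.coe_openNormalSubgroup_le h))
        ((resD ℤ U).obj (classData F).toSystem.toD) 2 c) = relLayerInv U hE c := by
  haveI := finite_gal F E
  haveI := finite_gal F E'
  letI := GalLayer.algebraOfLE h
  haveI := GalLayer.isScalarTower_of_le h
  have hm : 0 < Module.finrank E.1 E'.1 := by
    haveI := E'.numberField
    haveI := E'.isGalois
    have hne := (IdeleCohomology.neZero_finrank F E'.1).ne
    rw [finrank_eq_mul_of_le h] at hne
    exact Nat.pos_of_ne_zero (right_ne_zero_of_mul hne)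
  rw [relLayerInv_apply, relLayerInv_apply, (classData F).relLayerCohomologyIso_stepG hE hE' h 2 c]
  obtain ⟨r, hr⟩ := exists_zsmul_resFundamentalClass_eq U E (((classData F).relLayerCohomologyIso (U := U) hE 2).hom c)
  rw [← hr]
  -- `relInf (r • res u_E) = r • [E':E] • res u_{E'}`
  have h1 : (classData F).relInf U h 2 (r • resFundamentalClass U E) =
      r • (Module.finrank E.1 E'.1 • resFundamentalClass U E') := by
    rw [moduleCat_hom_zsmul, relInf_resFundamentalClass U h]
  rw [h1, ← natCast_zsmul, ← mul_zsmul, invSub_zsmul_resFundamentalClass, invSub_zsmul_resFundamentalClass,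
    card_subgroupImage_eq_mul U hE h, mul_zsmul, natCast_zsmul, nsmul_oneDiv_mul hm]

/-- **The index set of the relative layers at `U`**: the layers `E` with `U_E ≤ U` (for `U = Gal(F̄/L)`: `E ⊇ L`),
each giving the trace layer `U_E ∩ U` of door-c6. [cite: SerreGaloisCohomology1997, I §2.2 Proposition 8] -/
def subLayerTrace (E : {E : GalLayer F // (E.openNormalSubgroup : Subgroup (absoluteGaloisGroup F)) ≤ U}) :
    OpenNormalSubgroup U :=
  traceOpenNormalSubgroup U E.1.openNormalSubgroup

omit [NumberField F] in
/-- Formula. [cite: SerreGaloisCohomology1997, I §2.2 Proposition 8] -/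
theorem subLayerTrace_apply (E : {E : GalLayer F // (E.openNormalSubgroup : Subgroup (absoluteGaloisGroup F)) ≤ U}) :
    subLayerTrace U E = traceOpenNormalSubgroup U E.1.openNormalSubgroup := rfl

/-- Comparison of trace layers detects the order of the layers: `U_{E'} ∩ U ≤ U_E ∩ U` with `U_{E'} ≤ U` gives `E ≤ E'`.
[cite: SerreGaloisCohomology1997, I §2.2 Proposition 8] -/
theorem le_of_trace_le {E E' : GalLayer F} (hE' : (E'.openNormalSubgroup : Subgroup (absoluteGaloisGroup F)) ≤ U)
    (h : (traceOpenNormalSubgroup U E'.openNormalSubgroup : Subgroup U) ≤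
      traceOpenNormalSubgroup U E.openNormalSubgroup) : E ≤ E' := by
  refine GalLayer.openNormalSubgroup_le_iff.1 fun σ hσ => ?_
  have hσU : σ ∈ U := hE' hσ
  exact (mem_traceOpenNormalSubgroup_iff U E.openNormalSubgroup ⟨σ, hσU⟩).1
    (h ((mem_traceOpenNormalSubgroup_iff U E'.openNormalSubgroup ⟨σ, hσU⟩).2 hσ))

/-- **The relative invariants form a compatible family on the cofinal family of trace layers of `U`** (`U` open, `Γ_F`
profinite: cofinality by door-c6's `exists_traceOpenNormalSubgroup_le`; compatibility `relLayerInv_stepG`).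
[cite: SerreGaloisCohomology1997, I §2.2 Proposition 8][cite: Serre1979, XI §3] -/
theorem isCompatibleFamily_relLayerInv [CompactSpace (absoluteGaloisGroup F)]
    [TotallyDisconnectedSpace (absoluteGaloisGroup F)] (hU : IsOpen (U : Set (absoluteGaloisGroup F))) :
    haveI : CompactSpace U := LayerColimit.compactSpace_subgroup_of_isOpen U hU
    LayerColimit.IsCompatibleFamily (subLayerTrace U) ((resD ℤ U).obj (classData F).toSystem.toD) 2
      (fun E => relLayerInv U E.2) := by
  haveI : CompactSpace U := LayerColimit.compactSpace_subgroup_of_isOpen U hU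
  refine ⟨fun W => ?_, fun E E' h c => ?_⟩
  · obtain ⟨V, hVU, hVW⟩ := exists_traceOpenNormalSubgroup_le U hU W
    refine ⟨⟨GalLayer.ofOpenNormalSubgroup V, ?_⟩, ?_⟩
    · rw [GalLayer.openNormalSubgroup_ofOpenNormalSubgroup]
      exact hVU
    · change (traceOpenNormalSubgroup U (GalLayer.ofOpenNormalSubgroup V).openNormalSubgroup : Subgroup U) ≤ W
      rw [GalLayer.openNormalSubgroup_ofOpenNormalSubgroup]
      exact hVW
  · exact relLayerInv_stepG U E.2 E'.2 (le_of_trace_le U E'.2 h) c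

end Relative

end IdeleClassBar

end Literature.NumberTheory.GaloisRepresentations

end
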